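import Summits.NavierStokesRegularity.NavierStokesRegularity.Theorems.EulerZoomLiouvillePowerGaugeEulerLiouvilleEnergySaturationMember
import Literature.Analysis.FluidPDE.SelfSimilarEulerHomogeneousTail
import Literature.Analysis.FluidPDE.HomogeneousEulerAxisymmetric
import HarnessLib

/-!
# The homogeneous-tail sub-case of the C1 residue of the crux `EulerZoomLiouville.PowerGaugeEulerLiouville`
# is Shvydkoy's homogeneous STATIONARY Euler problem
# (crux = stmt-NavierStokesRegularity-19832, route №10 `EulerZoomLiouville`, line `birth`, lead g4)

Registered skeleton v9 (lead g4) splits the crux's open core into `stub_selfSimilarExtremal` (exactly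
self-similar members whose normalised profile energy `L^{2ρ−1}∫_{B_L}|V|²` stays `≥ ε > 0` — the
Chae–Shvydkoy window proper) and `stub_nonSelfSimilar`.  For an extremal profile the shell energies are
two-sided `≍ L^{1−2ρ}` (w2's `EnergySaturation.tendsto_normEnergy`), i.e. `|V| ≍ |y|^{−(1+ρ)}` in shell
average; the cleanest sub-case is a profile that is EXACTLY homogeneous of the scaling degree `−(1+ρ)`
outside a ball (Chae–Shvydkoy 2013 §4.1; their Thm 4.2 excludes every other homogeneity degree).  This file
records, at member level and in the crux's exponents, what that sub-case IS:

* `selfSimilarProfile_isHomogeneousSteadyEuler_of_homogeneous_tail` — (`0 < ρ`) a `C²/C¹` profile of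
  exponent `γ = 1/(2+ρ)` agreeing outside a ball with a globally homogeneous pair `(W, Q)` of degrees
  `(−(1+ρ), −2(1+ρ))` makes `(W, Q)` a homogeneous STATIONARY Euler pair of degree `α = 1+ρ` in Shvydkoy's
  sense (`IsHomogeneousSteadyEuler (1+ρ) W Q`; bridge `…isHomogeneousSteadyEuler_of_homogeneous_tail`).
  For the window `ρ ∈ (0,1/2]` this is `α ∈ (1,3/2]`, where NO exclusion of `C¹` homogeneous stationary
  solutions is in print: Shvydkoy 2018 (Trans. AMS 370, p.4) CONJECTURES there are none for `α > −1` except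
  the irrotational ones at `α ∈ ℤ ∖ {1}`, and proves it for `α = 1`, for axisymmetric solutions
  (`0 < α < 2`, Prop. 5.1), for spherical pressure `p ≥ 0` (Cor. 4.4), and irrotational ⇒ `α ∈ ℤ` (Prop. 3.1).
* `selfSimilar_ae_eq_zero_of_profile_eq_zero_offBall` — (`0 < ρ < 1/2`) crux hypotheses verbatim + exact
  self-similarity: if the profile VANISHES outside some ball the member is trivial (the normalised energy is
  then `≤ L^{2ρ−1}·const → 0`: w2's `selfSimilar_ae_eq_zero_of_subExtremal`).
* `selfSimilar_ae_eq_zero_of_homogeneous_tail_of_exclusion` — (`0 < ρ < 1/2`) the honest plug: ANY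
  Liouville statement for Shvydkoy's system that applies to the member's tail `(W, Q)` kills the member.
* `selfSimilar_ae_eq_zero_of_axisymmetric_homogeneous_tail` — worked instance with the printed
  Prop. 5.1 (tree FACT `shvydkoy2018_prop51_noAxisymmetric`, hence CONDITIONAL on it): axisymmetric `C²`
  homogeneous tails are excluded (this stratum is also covered, differently, by typeII-p3's transport files).

WHAT THIS IS NOT: not NS regularity, not the crux, not rung C1 — it identifies a named printed OPEN problem
(Shvydkoy's conjecture for `α ∈ (1,3/2]`) inside the registered stub `stub_selfSimilarExtremal`;
`--supports` stmt-19832. [folklore; cf. ChaeShvydkoy2013 §4.1, Shvydkoy2018 §1]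
-/

noncomputable section

set_option linter.dupNamespace false

open MeasureTheory Set Filter Topology Metric Function TopologicalSpace
open scoped ENNReal NNReal

namespace Summit.NavierStokesRegularity.NavierStokesRegularity.Theorems.PowerGaugeEulerLiouville

open Literature.Analysis Literature.Analysis.FunctionSpaces Literature.Analysis.FluidPDE

namespace HomogeneousTail

/-- **The homogeneous tail of a self-similar profile in the crux's exponents is a Shvydkoy pair of degree
`1+ρ`.**  (`γ = 1/(2+ρ)`, `γ·(1+ρ) = 1 − γ`.) [cite: ChaeShvydkoy2013, §4.1] -/
theorem selfSimilarProfile_isHomogeneousSteadyEuler_of_homogeneous_tail {ρ : ℝ} (hρ : 0 < ρ)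
    {V W : EuclideanSpace ℝ (Fin 3) → EuclideanSpace ℝ (Fin 3)} {P Q : EuclideanSpace ℝ (Fin 3) → ℝ} {R : ℝ}
    (hprof : IsSelfSimilarEulerProfile (1 / (2 + ρ)) 0 V P)
    (hW : ∀ ⦃c : ℝ⦄, 0 < c → ∀ ⦃x : EuclideanSpace ℝ (Fin 3)⦄, x ≠ 0 → W (c • x) = c ^ (-(1 + ρ)) • W x)
    (hQ : ∀ ⦃c : ℝ⦄, 0 < c → ∀ ⦃x : EuclideanSpace ℝ (Fin 3)⦄, x ≠ 0 →
      Q (c • x) = c ^ (-(2 * (1 + ρ))) * Q x)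
    (hVW : ∀ ⦃y : EuclideanSpace ℝ (Fin 3)⦄, R < ‖y‖ → V y = W y)
    (hPQ : ∀ ⦃y : EuclideanSpace ℝ (Fin 3)⦄, R < ‖y‖ → P y = Q y) :
    IsHomogeneousSteadyEuler (1 + ρ) W Q := by
  have h2ρ : (2 + ρ) ≠ 0 := by linarith
  have hαγ : 1 / (2 + ρ) * (1 + ρ) = 1 - 1 / (2 + ρ) := by field_simp; ring
  exact hprof.isHomogeneousSteadyEuler_of_homogeneous_tail hαγ hW hQ hVW hPQ

/-- **A profile vanishing outside a ball gives a trivial member (`0 < ρ < 1/2`).**  Crux hypotheses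
verbatim + exact self-similarity; the normalised energy is `≤ L^{2ρ−1}∫_{B_R}|V|² → 0`, so w2's energy
saturation applies. [folklore] -/
theorem selfSimilar_ae_eq_zero_of_profile_eq_zero_offBall {ρ : ℝ} (hρ : 0 < ρ) (hρ2 : ρ < 1 / 2)
    {u : ℝ → EuclideanSpace ℝ (Fin 3) → EuclideanSpace ℝ (Fin 3)} {p : ℝ → EuclideanSpace ℝ (Fin 3) → ℝ}
    {H : ℝ → EuclideanSpace ℝ (Fin 3) → EuclideanSpace ℝ (Fin 3) →L[ℝ] EuclideanSpace ℝ (Fin 3)} {c : ℝ≥0}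
    (hsw : IsSuitableWeakSolutionOn (slab (EuclideanSpace ℝ (Fin 3)) (Iio 0) isOpen_Iio) 0 0 u p)
    (hH : HasWeakSpatialGradientOn (slab (EuclideanSpace ℝ (Fin 3)) (Iio 0) isOpen_Iio) u H)
    (hgauge : ∀ a : ℝ, 0 < a →
      ENNReal.ofReal (a ^ (2 * ρ)) * cknA a (0 : ℝ × EuclideanSpace ℝ (Fin 3)) u +
          ENNReal.ofReal (a ^ ρ) * cknE a (0 : ℝ × EuclideanSpace ℝ (Fin 3)) H +
        ENNReal.ofReal (a ^ (2 * ρ)) * cknD a (0 : ℝ × EuclideanSpace ℝ (Fin 3)) p ≤ (c : ℝ≥0∞))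
    {V : EuclideanSpace ℝ (Fin 3) → EuclideanSpace ℝ (Fin 3)} {P : EuclideanSpace ℝ (Fin 3) → ℝ}
    (hu : ∀ τ : ℝ, τ < 0 → u τ = selfSimilarCollapse (1 / (2 + ρ)) 0 V τ)
    (hp : ∀ τ : ℝ, τ < 0 → p τ = selfSimilarCollapsePressure (1 / (2 + ρ)) 0 P τ)
    {R : ℝ} (hVR : ∀ ⦃y : EuclideanSpace ℝ (Fin 3)⦄, R < ‖y‖ → V y = 0) :
    uncurry u =ᵐ[volume.restrict (Iio (0 : ℝ) ×ˢ (univ : Set (EuclideanSpace ℝ (Fin 3))))] 0 := by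
  -- the energy in `B_L` is the energy in `B_{R₁}`, `R₁ = max R 0 + 1`, for `L ≥ R₁`
  set R₁ : ℝ := max R 0 + 1 with hR₁
  have hRR₁ : R < R₁ := by rw [hR₁]; linarith [le_max_left R 0]
  set M : ℝ := ∫ y in ball (0 : EuclideanSpace ℝ (Fin 3)) R₁, ‖V y‖ ^ 2 with hM
  have hM0 : 0 ≤ M := integral_nonneg fun y => sq_nonneg _
  have hconst : ∀ L : ℝ, R₁ ≤ L → ∫ y in ball (0 : EuclideanSpace ℝ (Fin 3)) L, ‖V y‖ ^ 2 = M := by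
    intro L hL
    rw [hM]
    refine setIntegral_eq_of_subset_of_forall_sdiff_eq_zero measurableSet_ball (ball_subset_ball hL) ?_
    intro y hy
    have hyR : R < ‖y‖ := by
      have h2 : y ∉ ball (0 : EuclideanSpace ℝ (Fin 3)) R₁ := hy.2
      rw [mem_ball, dist_zero_right, not_lt] at h2
      exact lt_of_lt_of_le hRR₁ h2
    rw [hVR hyR, norm_zero]; ring
  -- `L^{2ρ−1} M → 0`
  have hexp : 0 < 1 - 2 * ρ := by linarith
  have htend : Tendsto (fun L : ℝ => L ^ (2 * ρ - 1) * M) atTop (𝓝 0) := by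
    have h1 : Tendsto (fun L : ℝ => L ^ (-(1 - 2 * ρ))) atTop (𝓝 0) := tendsto_rpow_neg_atTop hexp
    have h2 : (fun L : ℝ => L ^ (2 * ρ - 1) * M) = fun L => L ^ (-(1 - 2 * ρ)) * M := by
      funext L; rw [show (2 * ρ - 1) = -(1 - 2 * ρ) by ring]
    rw [h2, show (0 : ℝ) = 0 * M by ring]
    exact h1.mul_const M
  refine EnergySaturation.selfSimilar_ae_eq_zero_of_subExtremal hρ (by linarith) hsw hH hgauge hu hp ?_
  intro ε hε L₀
  have hev : ∀ᶠ L : ℝ in atTop, L ^ (2 * ρ - 1) * M < ε :=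
    (tendsto_order.1 htend).2 ε hε
  obtain ⟨L, hL⟩ := (hev.and (eventually_ge_atTop (max L₀ R₁))).exists
  refine ⟨L, le_trans (le_max_left _ _) hL.2, ?_⟩
  rw [hconst L (le_trans (le_max_right _ _) hL.2)]
  exact hL.1

/-- **The honest plug (`0 < ρ < 1/2`)**: an exactly self-similar member of the crux's class whose `C²/C¹`
profile agrees outside a ball with a globally homogeneous pair `(W, Q)` of the scaling degrees is trivial AS
SOON AS some Liouville statement for Shvydkoy's homogeneous stationary system applies to `(W, Q)` — in the
window `1 + ρ ∈ (1, 3/2)` that statement is Shvydkoy's 2018 open conjecture. [folklore; cf. Shvydkoy2018 §1] -/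
theorem selfSimilar_ae_eq_zero_of_homogeneous_tail_of_exclusion {ρ : ℝ} (hρ : 0 < ρ) (hρ2 : ρ < 1 / 2)
    {u : ℝ → EuclideanSpace ℝ (Fin 3) → EuclideanSpace ℝ (Fin 3)} {p : ℝ → EuclideanSpace ℝ (Fin 3) → ℝ}
    {H : ℝ → EuclideanSpace ℝ (Fin 3) → EuclideanSpace ℝ (Fin 3) →L[ℝ] EuclideanSpace ℝ (Fin 3)} {c : ℝ≥0}
    (hsw : IsSuitableWeakSolutionOn (slab (EuclideanSpace ℝ (Fin 3)) (Iio 0) isOpen_Iio) 0 0 u p)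
    (hH : HasWeakSpatialGradientOn (slab (EuclideanSpace ℝ (Fin 3)) (Iio 0) isOpen_Iio) u H)
    (hgauge : ∀ a : ℝ, 0 < a →
      ENNReal.ofReal (a ^ (2 * ρ)) * cknA a (0 : ℝ × EuclideanSpace ℝ (Fin 3)) u +
          ENNReal.ofReal (a ^ ρ) * cknE a (0 : ℝ × EuclideanSpace ℝ (Fin 3)) H +
        ENNReal.ofReal (a ^ (2 * ρ)) * cknD a (0 : ℝ × EuclideanSpace ℝ (Fin 3)) p ≤ (c : ℝ≥0∞))
    {V W : EuclideanSpace ℝ (Fin 3) → EuclideanSpace ℝ (Fin 3)} {P Q : EuclideanSpace ℝ (Fin 3) → ℝ} {R : ℝ}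
    (hu : ∀ τ : ℝ, τ < 0 → u τ = selfSimilarCollapse (1 / (2 + ρ)) 0 V τ)
    (hp : ∀ τ : ℝ, τ < 0 → p τ = selfSimilarCollapsePressure (1 / (2 + ρ)) 0 P τ)
    (hprof : IsSelfSimilarEulerProfile (1 / (2 + ρ)) 0 V P)
    (hW : ∀ ⦃c : ℝ⦄, 0 < c → ∀ ⦃x : EuclideanSpace ℝ (Fin 3)⦄, x ≠ 0 → W (c • x) = c ^ (-(1 + ρ)) • W x)
    (hQ : ∀ ⦃c : ℝ⦄, 0 < c → ∀ ⦃x : EuclideanSpace ℝ (Fin 3)⦄, x ≠ 0 →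
      Q (c • x) = c ^ (-(2 * (1 + ρ))) * Q x)
    (hVW : ∀ ⦃y : EuclideanSpace ℝ (Fin 3)⦄, R < ‖y‖ → V y = W y)
    (hPQ : ∀ ⦃y : EuclideanSpace ℝ (Fin 3)⦄, R < ‖y‖ → P y = Q y)
    (hexcl : IsHomogeneousSteadyEuler (1 + ρ) W Q → ∀ ⦃x : EuclideanSpace ℝ (Fin 3)⦄, x ≠ 0 → W x = 0) :
    uncurry u =ᵐ[volume.restrict (Iio (0 : ℝ) ×ˢ (univ : Set (EuclideanSpace ℝ (Fin 3))))] 0 := by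
  have hHSE := selfSimilarProfile_isHomogeneousSteadyEuler_of_homogeneous_tail hρ hprof hW hQ hVW hPQ
  have hW0 := hexcl hHSE
  refine selfSimilar_ae_eq_zero_of_profile_eq_zero_offBall hρ hρ2 hsw hH hgauge hu hp (R := max R 0) ?_
  intro y hy
  have hy0 : y ≠ 0 := by
    intro h; rw [h, norm_zero] at hy; exact absurd hy (not_lt.2 (le_max_right _ _))
  rw [hVW (lt_of_le_of_lt (le_max_left _ _) hy)]
  exact hW0 hy0

/-- **Worked instance (CONDITIONAL on the printed fact `shvydkoy2018_prop51_noAxisymmetric`,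
Shvydkoy 2018 Prop. 5.1)**: for `0 < ρ < 1/2`, an exactly self-similar member whose `C²/C¹` profile has an
AXISYMMETRIC `C²` homogeneous tail of the scaling degrees is trivial (`0 < 1+ρ < 2`). [cite: Shvydkoy2018, Prop 5.1] -/
theorem selfSimilar_ae_eq_zero_of_axisymmetric_homogeneous_tail
    (h51 : shvydkoy2018_prop51_noAxisymmetric) {ρ : ℝ} (hρ : 0 < ρ) (hρ2 : ρ < 1 / 2)
    {u : ℝ → EuclideanSpace ℝ (Fin 3) → EuclideanSpace ℝ (Fin 3)} {p : ℝ → EuclideanSpace ℝ (Fin 3) → ℝ}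
    {H : ℝ → EuclideanSpace ℝ (Fin 3) → EuclideanSpace ℝ (Fin 3) →L[ℝ] EuclideanSpace ℝ (Fin 3)} {c : ℝ≥0}
    (hsw : IsSuitableWeakSolutionOn (slab (EuclideanSpace ℝ (Fin 3)) (Iio 0) isOpen_Iio) 0 0 u p)
    (hH : HasWeakSpatialGradientOn (slab (EuclideanSpace ℝ (Fin 3)) (Iio 0) isOpen_Iio) u H)
    (hgauge : ∀ a : ℝ, 0 < a →
      ENNReal.ofReal (a ^ (2 * ρ)) * cknA a (0 : ℝ × EuclideanSpace ℝ (Fin 3)) u +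
          ENNReal.ofReal (a ^ ρ) * cknE a (0 : ℝ × EuclideanSpace ℝ (Fin 3)) H +
        ENNReal.ofReal (a ^ (2 * ρ)) * cknD a (0 : ℝ × EuclideanSpace ℝ (Fin 3)) p ≤ (c : ℝ≥0∞))
    {V W : EuclideanSpace ℝ (Fin 3) → EuclideanSpace ℝ (Fin 3)} {P Q : EuclideanSpace ℝ (Fin 3) → ℝ} {R : ℝ}
    (hu : ∀ τ : ℝ, τ < 0 → u τ = selfSimilarCollapse (1 / (2 + ρ)) 0 V τ)
    (hp : ∀ τ : ℝ, τ < 0 → p τ = selfSimilarCollapsePressure (1 / (2 + ρ)) 0 P τ)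
    (hprof : IsSelfSimilarEulerProfile (1 / (2 + ρ)) 0 V P)
    (hW : ∀ ⦃c : ℝ⦄, 0 < c → ∀ ⦃x : EuclideanSpace ℝ (Fin 3)⦄, x ≠ 0 → W (c • x) = c ^ (-(1 + ρ)) • W x)
    (hQ : ∀ ⦃c : ℝ⦄, 0 < c → ∀ ⦃x : EuclideanSpace ℝ (Fin 3)⦄, x ≠ 0 →
      Q (c • x) = c ^ (-(2 * (1 + ρ))) * Q x)
    (hVW : ∀ ⦃y : EuclideanSpace ℝ (Fin 3)⦄, R < ‖y‖ → V y = W y)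
    (hPQ : ∀ ⦃y : EuclideanSpace ℝ (Fin 3)⦄, R < ‖y‖ → P y = Q y)
    (hWC2 : ContDiffOn ℝ 2 W {x | x ≠ 0}) (hQC2 : ContDiffOn ℝ 2 Q {x | x ≠ 0})
    (hax : IsAxisymmetric W) (haxQ : IsAxisymmetricScalar Q) :
    uncurry u =ᵐ[volume.restrict (Iio (0 : ℝ) ×ˢ (univ : Set (EuclideanSpace ℝ (Fin 3))))] 0 :=
  selfSimilar_ae_eq_zero_of_homogeneous_tail_of_exclusion hρ hρ2 hsw hH hgauge hu hp hprof hW hQ hVW hPQ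
    fun hHSE _ hx => h51 (by linarith) (by linarith) hHSE hWC2 hQC2 hax haxQ _ hx

end HomogeneousTail

end Summit.NavierStokesRegularity.NavierStokesRegularity.Theorems.PowerGaugeEulerLiouville

end
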